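import Literature.Barriers.AnomalousDissipation.ObukhovCorrsinThresholdProofs
import HarnessLib

/-!
# The logarithmic edge of the Obukhov–Corrsin block

Barrier-audit addendum (2026-08-17, gen 10, D-0021) to the named fact
`Literature.Barriers.AnomalousDissipation.DrivasElgindiIyerJeong2022_thm4`
(`Barriers/AnomalousDissipation/ObukhovCorrsinThreshold`, scope caveat (xii)).

The block fixes ONE scalar exponent `β > β* := (1-α)/2` for a whole family `κ_j → 0`. The
discharge `DrivasElgindiIyerJeong2022_thm4_holds` (`ObukhovCorrsinThresholdProofs`) produces an
EXPLICIT constant, and at the printed scale `ℓ = ¼κ^{1/(α+1)}` the fixed-scale bound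
`DrivasElgindiIyerJeong2022_thm4.two_mul_eScalarDissipation_le`,
`2κ∫₀ᵀ‖∇θ‖² ≤ M²ℓ^{2β} + 4dC₁M²K ℓ^{α+2β-1} + 2dC₁²TM² κℓ^{2β-2}`, `ℓ ∈ (0, ¼]`,
reads, for ANY exponent `β ∈ (0,1]` and `0 < κ ≤ 1`,
`2κ∫₀ᵀ‖∇θ‖² ≤ (1 + 16dC₁K + 32dC₁²T) M² κ^{2(β-β*)/(α+1)}`
(the three powers of `¼` are at most `1, 4, 16`, and `κ^{2β/(α+1)} ≤ κ^{2(β-β*)/(α+1)}` because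
`α ≤ 1`). Consequently, along a family of velocity fields with `‖u_j‖_{L¹_tC^{0,α}} ≤ K`, data and
weak solutions bounded by `M` in `C^{0,β_j}` resp. `L^∞_t C^{0,β_j}` with `j`-DEPENDENT exponents
`β_j ∈ (0,1]`, the scalar dissipation tends to `0` as soon as
`(β_j - β*) · log(1/κ_j) → +∞`
(`DrivasElgindiIyerJeong2022_thm4.noAnomaly_of_logSeparated_exponents`). At a fixed `β > β*` this
is the corollary `DrivasElgindiIyerJeong2022_thm4.noAnomalousScalarDissipation` of the barrier file;
the point of the present form is the EDGE of the block: when `(β_j - β*) log(1/κ_j)` stays bounded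
— in particular on the critical line `β_j ≡ β*`, the Obukhov–Corrsin scaling itself — the
commutator bound is `O(1)` and the block is silent (Drivas–Elgindi–Iyer–Jeong's second assertion
closes the critical line only for fields in `L¹_loc([0,T); W^{1,∞})`, i.e. rough at the final
instant alone). Since for `K > 0` the bound (5.10) minimised over ALL scales `ℓ` is
`≍ κ^{2(β-β*)/(α+1)}` (the flux term `Kℓ^{α+2β-1}` and the resolved-dissipation term `Tκℓ^{2β-2}`
balance exactly at `ℓ^{α+1} ≍ κ`; at `β = β*` the flux term is the constant `4dC₁M²K`), the
logarithmic separation is the exact edge of the printed method, not of the scale choice. This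
is a reading of the explicit constant, recorded as a theorem so that route planners can cite the
exact edge; no new mathematics.

Deliberately NOT here (scope caveat (xii) of the barrier file, on paper): the one rigid statement
ON the critical line that the identity (5.9) still gives — families UNIFORMLY LITTLE at the
critical exponent, `sup_{j,t,|z|≤ℓ} |z|^{-β*}‖δ_zθ_j(t)‖_∞ → 0` as `ℓ → 0`, carry no anomaly, because
(5.9) at scale `ℓ = κ^{1/(α+1)}` involves only increments `|z| ≤ ℓ` — and its transcription to the
long-time forced regime of crux `ScalarAnomalySteadySourceFormal` (threshold `1/5`, scale `ν^{5/8}`,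
scope caveat (ix)).

## Contents

* `LogEdge.rpow_tendsto_zero_of_mul_log` — `κ_j^{e_j} → 0` when `e_j log(1/κ_j) → +∞`;
* `LogEdge.threeTerm_le` — the three terms of (5.10) at `ℓ = ¼κ^{1/(α+1)}`, any exponent;
* `DrivasElgindiIyerJeong2022_thm4.noAnomaly_of_logSeparated_exponents` — the family statement.

## References

* T. D. Drivas, T. M. Elgindi, G. Iyer, I.-J. Jeong, Arch. Ration. Mech. Anal. 243 (2022)
  1151–1180, Thm. 4 (both assertions) and its proof, §5, (5.9)–(5.10) (arXiv:1911.03271,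
  pp. 17–18). Bib key `DrivasEtAl2022`.
-/

open MeasureTheory Set Filter Topology Function
open scoped ENNReal NNReal

noncomputable section

namespace Literature.Barriers.AnomalousDissipation

open Literature.Analysis Literature.Analysis.FunctionSpaces Literature.Analysis.FluidPDE

namespace LogEdge

/-- **Powers with slowly vanishing exponents**: if `0 < κ_j` and `e_j · log(1/κ_j) → +∞` then
`κ_j^{e_j} → 0` (`κ^e = exp(-e log(1/κ))`). [folklore] -/
theorem rpow_tendsto_zero_of_mul_log {κ e : ℕ → ℝ} (hκ : ∀ j, 0 < κ j)
    (h : Tendsto (fun j => e j * Real.log (κ j)⁻¹) atTop atTop) :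
    Tendsto (fun j => κ j ^ e j) atTop (𝓝 0) := by
  have hrw : (fun j => κ j ^ e j) = fun j => Real.exp (-(e j * Real.log (κ j)⁻¹)) := by
    funext j
    rw [Real.rpow_def_of_pos (hκ j), Real.log_inv]
    ring_nf
  rw [hrw]
  exact Real.tendsto_exp_neg_atTop_nhds_zero.comp h

/-- **The three terms of (5.10) at the printed scale, any exponent**: for `0 < α ≤ 1`, `0 < β`,
`0 < κ ≤ 1`, `γ = 1/(α+1)` and nonnegative `a, b, c, K, T`,
`a(¼κ^γ)^{2β} + 2(b(¼κ^γ)^{α+2β-1}K + Tκ c(¼κ^γ)^{2β-2}) ≤ (a + 8bK + 32Tc) κ^{γ(α+2β-1)}`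
(`(¼)^{2β} ≤ 1`, `(¼)^{α+2β-1} ≤ 4`, `(¼)^{2β-2} ≤ 16`; `κ·κ^{γ(2β-2)} = κ^{γ(α+2β-1)}`;
`κ^{2βγ} ≤ κ^{γ(α+2β-1)}` as `α ≤ 1`, `κ ≤ 1`). [folklore] -/
theorem threeTerm_le {α β κ γ a b c K T : ℝ} (hα : 0 < α) (hα1 : α ≤ 1) (hβ : 0 < β)
    (hκ : 0 < κ) (hκ1 : κ ≤ 1) (hγ : γ = (α + 1)⁻¹) (ha : 0 ≤ a) (hb : 0 ≤ b)
    (hc : 0 ≤ c) (hK : 0 ≤ K) (hT : 0 ≤ T) :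
    a * (4⁻¹ * κ ^ γ) ^ (2 * β) +
        2 * ((b * (4⁻¹ * κ ^ γ) ^ (α + 2 * β - 1)) * K +
          T * (κ * (c * (4⁻¹ * κ ^ γ) ^ (2 * β - 2)))) ≤
      (a + 8 * b * K + 32 * T * c) * κ ^ (γ * (α + 2 * β - 1)) := by
  have hα1pos : 0 < α + 1 := by linarith
  have hγpos : 0 < γ := by rw [hγ]; positivity
  have hκγ : 0 ≤ κ ^ γ := Real.rpow_nonneg hκ.le γ
  have hpow : ∀ p : ℝ, (4⁻¹ * κ ^ γ) ^ p = (4⁻¹ : ℝ) ^ p * κ ^ (γ * p) := fun p => by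
    rw [Real.mul_rpow (by norm_num) hκγ, Real.rpow_mul hκ.le]
  have hX : 0 ≤ κ ^ (γ * (α + 2 * β - 1)) := Real.rpow_nonneg hκ.le _
  have h4pos : (0 : ℝ) < 4⁻¹ := by norm_num
  have h4le : (4⁻¹ : ℝ) ≤ 1 := by norm_num
  -- the three powers of `¼`
  have q1 : (4⁻¹ : ℝ) ^ (2 * β) ≤ 1 := Real.rpow_le_one h4pos.le h4le (by positivity)
  have q2 : (4⁻¹ : ℝ) ^ (α + 2 * β - 1) ≤ 4 := by
    have h : (4⁻¹ : ℝ) ^ (α + 2 * β - 1) ≤ (4⁻¹ : ℝ) ^ (-1 : ℝ) :=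
      Real.rpow_le_rpow_of_exponent_ge h4pos h4le (by linarith)
    rwa [Real.rpow_neg_one, inv_inv] at h
  have q3 : (4⁻¹ : ℝ) ^ (2 * β - 2) ≤ 16 := by
    have h : (4⁻¹ : ℝ) ^ (2 * β - 2) ≤ (4⁻¹ : ℝ) ^ (-2 : ℝ) :=
      Real.rpow_le_rpow_of_exponent_ge h4pos h4le (by linarith)
    have h16 : (4⁻¹ : ℝ) ^ (-2 : ℝ) = 16 := by
      rw [Real.rpow_neg h4pos.le, Real.inv_rpow (by norm_num : (0 : ℝ) ≤ 4), inv_inv,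
        show (2 : ℝ) = ((2 : ℕ) : ℝ) by norm_num, Real.rpow_natCast]
      norm_num
    rwa [h16] at h
  -- the powers of `κ`
  have k1 : κ ^ (γ * (2 * β)) ≤ κ ^ (γ * (α + 2 * β - 1)) := by
    refine Real.rpow_le_rpow_of_exponent_ge hκ hκ1 ?_
    have h0 : 0 ≤ γ * (1 - α) := mul_nonneg hγpos.le (by linarith)
    nlinarith
  have k3 : κ * κ ^ (γ * (2 * β - 2)) = κ ^ (γ * (α + 2 * β - 1)) := by
    have hexp : γ * (α + 2 * β - 1) = 1 + γ * (2 * β - 2) := by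
      rw [hγ]
      field_simp
      ring
    rw [hexp, Real.rpow_add hκ, Real.rpow_one]
  -- the three terms
  have hT1 : a * (4⁻¹ * κ ^ γ) ^ (2 * β) ≤ a * κ ^ (γ * (α + 2 * β - 1)) := by
    rw [hpow]
    refine mul_le_mul_of_nonneg_left ?_ ha
    calc (4⁻¹ : ℝ) ^ (2 * β) * κ ^ (γ * (2 * β)) ≤ 1 * κ ^ (γ * (α + 2 * β - 1)) :=
          mul_le_mul q1 k1 (Real.rpow_nonneg hκ.le _) zero_le_one
      _ = κ ^ (γ * (α + 2 * β - 1)) := one_mul _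
  have hT2 : (b * (4⁻¹ * κ ^ γ) ^ (α + 2 * β - 1)) * K ≤
      4 * b * K * κ ^ (γ * (α + 2 * β - 1)) := by
    rw [hpow]
    calc b * ((4⁻¹ : ℝ) ^ (α + 2 * β - 1) * κ ^ (γ * (α + 2 * β - 1))) * K
        ≤ b * (4 * κ ^ (γ * (α + 2 * β - 1))) * K := by gcongr
      _ = 4 * b * K * κ ^ (γ * (α + 2 * β - 1)) := by ring
  have hT3 : T * (κ * (c * (4⁻¹ * κ ^ γ) ^ (2 * β - 2))) ≤
      16 * T * c * κ ^ (γ * (α + 2 * β - 1)) := by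
    rw [hpow]
    calc T * (κ * (c * ((4⁻¹ : ℝ) ^ (2 * β - 2) * κ ^ (γ * (2 * β - 2)))))
        = T * c * (4⁻¹ : ℝ) ^ (2 * β - 2) * (κ * κ ^ (γ * (2 * β - 2))) := by ring
      _ = T * c * (4⁻¹ : ℝ) ^ (2 * β - 2) * κ ^ (γ * (α + 2 * β - 1)) := by rw [k3]
      _ ≤ T * c * 16 * κ ^ (γ * (α + 2 * β - 1)) := by gcongr
      _ = 16 * T * c * κ ^ (γ * (α + 2 * β - 1)) := by ring
  calc a * (4⁻¹ * κ ^ γ) ^ (2 * β) +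
        2 * ((b * (4⁻¹ * κ ^ γ) ^ (α + 2 * β - 1)) * K +
          T * (κ * (c * (4⁻¹ * κ ^ γ) ^ (2 * β - 2))))
      ≤ a * κ ^ (γ * (α + 2 * β - 1)) +
        2 * (4 * b * K * κ ^ (γ * (α + 2 * β - 1)) + 16 * T * c * κ ^ (γ * (α + 2 * β - 1))) :=
        add_le_add hT1 (mul_le_mul_of_nonneg_left (add_le_add hT2 hT3) (by norm_num))
    _ = (a + 8 * b * K + 32 * T * c) * κ ^ (γ * (α + 2 * β - 1)) := by ring

end LogEdge

/-! ## No anomalous dissipation under logarithmically separated exponents -/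

/-- **The logarithmic edge of the Obukhov–Corrsin block** (barrier audit 2026-08-17, gen 10;
the explicit constant of `DrivasElgindiIyerJeong2022_thm4_holds` read along `j`-dependent
exponents). Let `α ∈ (0,1]`, `β* := (1-α)/2`, and along `κ_j > 0`, `κ_j → 0`, let `u_j` be
velocity fields with `u_j ∈ L¹(0,T; C^{0,α})`, `‖u_j‖_{L¹_tC^{0,α}} ≤ K`, exponents `β_j ∈ (0,1]`,
data with `‖θ₀,ⱼ‖_{C^{0,β_j}} ≤ M` and weak solutions `θ_j` of `∂ₜθ + u_j·∇θ = κ_jΔθ` on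
`T^d × [0,T)` obeying the energy balance and `ess sup_t ‖θ_j(t)‖_{C^{0,β_j}} ≤ M`. If
`(β_j - β*) · log(1/κ_j) → +∞` then `κ_j ∫₀ᵀ ‖∇θ_j‖²_{L²} → 0`: by
`two_mul_eScalarDissipation_le` at `ℓ_j = ¼κ_j^{1/(α+1)}` and `LogEdge.threeTerm_le`,
`2κ_j∫₀ᵀ‖∇θ_j‖² ≤ (1 + 16dC₁K + 32dC₁²T)M² κ_j^{2(β_j-β*)/(α+1)}` once `κ_j ≤ 1`. At a fixed
`β_j ≡ β > β*` this is `DrivasElgindiIyerJeong2022_thm4.noAnomalousScalarDissipation`; for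
`(β_j - β*) log(1/κ_j)` bounded (e.g. `β_j ≡ β*`) the bound is `O(1)` and nothing follows.
[cite: DrivasEtAl2022, proof of Thm. 4, (5.10)] -/
theorem DrivasElgindiIyerJeong2022_thm4.noAnomaly_of_logSeparated_exponents
    (d : Type*) [Fintype d] [DecidableEq d] {T : ℝ} (hT : 0 < T) {α : ℝ≥0}
    (hα : 0 < α ∧ α ≤ 1) (β : ℕ → ℝ≥0) (hβ : ∀ j, 0 < β j ∧ β j ≤ 1) {K M : ℝ≥0}
    (κ : ℕ → ℝ) (hκ : ∀ j, 0 < κ j) (hκ₀ : Tendsto κ atTop (𝓝 0))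
    (hsep : Tendsto (fun j => ((β j : ℝ) - (1 - (α : ℝ)) / 2) * Real.log (κ j)⁻¹) atTop atTop)
    (u : ℕ → ℝ → UnitAddTorus d → EuclideanSpace ℝ d)
    (hu : ∀ j, MemLpHolder 1 α (u j) (Ioo 0 T))
    (huK : ∀ j, eLpHolderNorm 1 α (u j) (Ioo 0 T) ≤ K)
    (θ₀ : ℕ → UnitAddTorus d → ℝ) (hθ₀ : ∀ j, eBoundedHolderNorm (β j) (θ₀ j) ≤ M)
    (θ : ℕ → ℝ → UnitAddTorus d → ℝ)
    (hθ : ∀ j, Torus.IsWeakScalarTransportOn T (κ j) (u j) (θ₀ j) (θ j))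
    (henergy : ∀ j, ∀ᵐ t ∂((volume : Measure ℝ).restrict (Ioo 0 T)),
      (∫⁻ x, ‖θ j t x‖ₑ ^ 2) + 2 * Torus.eScalarDissipation (κ j) (θ j) 0 t ≤ ∫⁻ x, ‖θ₀ j x‖ₑ ^ 2)
    (hbound : ∀ j, ∀ᵐ t ∂((volume : Measure ℝ).restrict (Ioo 0 T)),
      eBoundedHolderNorm (β j) (θ j t) ≤ M) :
    Tendsto (fun j => Torus.eScalarDissipation (κ j) (θ j) 0 T) atTop (𝓝 0) := by
  -- constants
  have hα0 : (0 : ℝ) < α := by exact_mod_cast hα.1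
  have hα1 : (α : ℝ) ≤ 1 := by exact_mod_cast hα.2
  set γ : ℝ := ((α : ℝ) + 1)⁻¹ with hγ
  have hγpos : 0 < γ := by rw [hγ]; positivity
  set C₁ : ℝ := Torus.gradProfileMass d with hC₁
  have hC₁0 : 0 ≤ C₁ := Torus.gradProfileMass_nonneg
  set a : ℝ := (M : ℝ) ^ 2 with ha
  set b : ℝ := 2 * Fintype.card d * C₁ * (M : ℝ) ^ 2 with hb
  set c : ℝ := Fintype.card d * (C₁ ^ 2 * (M : ℝ) ^ 2) with hc
  have ha0 : 0 ≤ a := by positivity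
  have hb0 : 0 ≤ b := by positivity
  have hc0 : 0 ≤ c := by positivity
  set B : ℝ := a + 8 * b * K + 32 * T * c with hB
  -- the majorant `B κ_j^{γ(α+2β_j-1)}` tends to `0`
  have hexp : Tendsto (fun j => γ * ((α : ℝ) + 2 * β j - 1) * Real.log (κ j)⁻¹) atTop atTop := by
    have h := hsep.const_mul_atTop (by positivity : (0 : ℝ) < 2 * γ)
    refine h.congr fun j => ?_
    ring
  have hlim : Tendsto (fun j => B * κ j ^ (γ * ((α : ℝ) + 2 * β j - 1))) atTop (𝓝 0) := by
    have h := (LogEdge.rpow_tendsto_zero_of_mul_log (e := fun j => γ * ((α : ℝ) + 2 * β j - 1))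
      hκ hexp).const_mul B
    simpa using h
  have hup : Tendsto (fun j => ENNReal.ofReal (B * κ j ^ (γ * ((α : ℝ) + 2 * β j - 1)))) atTop
      (𝓝 0) := by
    have h := ENNReal.tendsto_ofReal hlim
    rwa [ENNReal.ofReal_zero] at h
  -- eventually `κ_j ≤ 1`, where the printed scale is admissible
  have hev : ∀ᶠ j in atTop, κ j ≤ 1 := (hκ₀.eventually (Iic_mem_nhds one_pos)).mono fun j hj => hj
  refine tendsto_of_tendsto_of_tendsto_of_le_of_le' tendsto_const_nhds hup
    (Eventually.of_forall fun _ => bot_le) (hev.mono fun j hj => ?_)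
  have hε : 0 < 4⁻¹ * κ j ^ γ := by have := hκ j; positivity
  have hε' : 4⁻¹ * κ j ^ γ ≤ 1 / 4 := by
    have : κ j ^ γ ≤ 1 := Real.rpow_le_one (hκ j).le hj hγpos.le
    linarith
  have hraw := DrivasElgindiIyerJeong2022_thm4.two_mul_eScalarDissipation_le hT (hβ j).1 (hu j)
    (huK j) (hθ₀ j) (hκ j) (hθ j) (henergy j) (hbound j) hε hε'
  have hthree := LogEdge.threeTerm_le (β := (β j : ℝ)) (a := a) (b := b) (c := c) (K := (K : ℝ))
    (T := T) hα0 hα1 (by exact_mod_cast (hβ j).1) (hκ j) hj hγ ha0 hb0 hc0 (NNReal.coe_nonneg K) hT.le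
  calc Torus.eScalarDissipation (κ j) (θ j) 0 T ≤ 2 * Torus.eScalarDissipation (κ j) (θ j) 0 T := by
        rw [two_mul]; exact le_self_add
    _ ≤ _ := hraw
    _ = ENNReal.ofReal (a * (4⁻¹ * κ j ^ γ) ^ (2 * (β j : ℝ)) +
          2 * ((b * (4⁻¹ * κ j ^ γ) ^ ((α : ℝ) + 2 * β j - 1)) * K +
            T * (κ j * (c * (4⁻¹ * κ j ^ γ) ^ (2 * (β j : ℝ) - 2))))) := by
        congr 1
        rw [ha, hb, hc]
        ring
    _ ≤ ENNReal.ofReal (B * κ j ^ (γ * ((α : ℝ) + 2 * β j - 1))) := ENNReal.ofReal_le_ofReal hthree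

end Literature.Barriers.AnomalousDissipation

end
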